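import Summits.CriticalPhenomena.SAWScalingLimit.Theorems.SAWDefectDecoherenceObservableToSLERCarvedReductionSqueezeJordanApprox
import Literature.Probability.RandomPlanarGeometry.ImageUnivalent
import HarnessLib

/-!
# The ENVELOPE `J` of the pinned frame: a large radial Schoenflies dilate of `D`, translated by
# `-τ` (piece (T-A′ P1-envelope) of stub T-A′ `stub_carvedReduction_squeezeGeometry_domains`)

Crux `SAWDevelopingMap.ObservableToSLE` (stmt-CriticalPhenomena-10472), line `six-class-type-ladder`,
stub T-A′ `stub_carvedReduction_squeezeGeometry_domains`.  Landing target: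
`Summits/CriticalPhenomena/SAWScalingLimit/Theorems/SAWDevelopingMapObservableToSLETypeLadderCarvedReductionSqueezeEnvelope.lean`
(`--supports stmt-CriticalPhenomena-10472`; registered carrier `stub_carvedReduction_envelope`).
Uses the twin's radial Schoenflies family `Squeeze.stub_carvedReduction_jordanApprox` (p130751).

The common super-domain of the moving-carving squeeze is cut out of an ENVELOPE `J ⊇ closure (D - τ)`
of the pinned limit domain (the pinned frame drifts by `τ_j - τ`, so `D - τ` itself is too small).
Design (worker log, item B): take `D`'s OWN radial Schoenflies homeomorphism `H` (so that every
modulus entering the choice of the locality scale `R₀` depends on `D` only), the unit directions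
`d i = u (D.mark i)` of the two marked points (`H (d i) = D.pt i`, `d 0 ≠ d 1`), and, for the
drift `τ` and any reach `ϱ₀`, a radius `r₂ > 1` so large that the translated dilate
`J = H (ball 0 r₂) - τ` contains the closed `ϱ₀`-balls about the pinned roots `D.pt i - τ`.
`stub_carvedReduction_envelope` records exactly this, with `J` a `JordanDomain` whose carrier and
frontier are the images of `ball 0 r₂`, `sphere 0 r₂` under the homeomorphism
`f = H.trans (addRight (-τ))` — the format of `stub_carvedReduction_coneExit`.
-/

noncomputable section
open Set Filter Metric Function
open _root_.Topology
open Literature.Probability.RandomPlanarGeometry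

namespace Summit.CriticalPhenomena.SAWScalingLimit.Theorems.ObservableToSLE.TypeLadder

open Summit.CriticalPhenomena.SAWScalingLimit.Theorems.ObservableToSLER.Squeeze
  (stub_carvedReduction_jordanApprox)

/-- **Registered carrier `stub_carvedReduction_envelope`** (crux item stmt-CriticalPhenomena-10472,
stub T-A′ `stub_carvedReduction_squeezeGeometry_domains`, piece THE ENVELOPE); see the module
docstring. -/
theorem stub_carvedReduction_envelope :
    ∀ (D : DobrushinDomain), ∃ (H : ℂ ≃ₜ ℂ) (d : Fin 2 → ℂ),
      (∀ i, ‖d i‖ = 1) ∧ d 0 ≠ d 1 ∧ (∀ i, H (d i) = D.pt i) ∧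
      H '' ball 0 1 = D.carrier ∧ H '' closedBall 0 1 = closure D.carrier ∧ H '' sphere 0 1 = frontier D.carrier ∧
      ∀ (τ : ℂ) (ϱ₀ : ℝ), ∃ (r₂ : ℝ) (J : JordanDomain), 1 < r₂ ∧
        J.carrier = (H.trans (Homeomorph.addRight (-τ))) '' ball 0 r₂ ∧
        frontier J.carrier = (H.trans (Homeomorph.addRight (-τ))) '' sphere 0 r₂ ∧
        (H.trans (Homeomorph.addRight (-τ))) '' ball 0 1 = (fun z => z - τ) '' D.carrier ∧
        (H.trans (Homeomorph.addRight (-τ))) '' closedBall 0 1 = closure ((fun z => z - τ) '' D.carrier) ∧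
        (∀ i, (H.trans (Homeomorph.addRight (-τ))) (d i) = D.pt i - τ) ∧
        (∀ i, closedBall (D.pt i - τ) ϱ₀ ⊆ J.carrier) ∧
        closure ((fun z => z - τ) '' D.carrier) ⊆ J.carrier := by
  intro D
  obtain ⟨H, u, Dr, hu1, -, -, huinj, -, -, hball, hsph, hcl, -, hDr, hpt, -, hclfr, -, hclsub, -⟩ :=
    stub_carvedReduction_jordanApprox D
  set d : Fin 2 → ℂ := fun i => u (D.mark i) with hd
  have hdn : ∀ i, ‖d i‖ = 1 := fun i => by
    have := hu1 (D.mark i); rwa [mem_sphere_zero_iff_norm] at this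
  have hd01 : d 0 ≠ d 1 := by
    intro h
    have := huinj (D.mark_mem 0) (D.mark_mem 1) h
    exact absurd this (D.strictMono_mark (show (0 : Fin 2) < 1 by decide)).ne
  refine ⟨H, d, hdn, hd01, fun i => (hpt i).symm, hball, hcl, hsph, fun τ ϱ₀ => ?_⟩
  -- the radius: `H⁻¹` of the two closed balls is compact, hence inside some `ball 0 r`
  set K : Set ℂ := closedBall (D.pt 0) ϱ₀ ∪ closedBall (D.pt 1) ϱ₀ ∪ closure D.carrier with hK
  have hKc : IsCompact K :=
    ((isCompact_closedBall _ _).union (isCompact_closedBall _ _)).union D.isBounded.isCompact_closure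
  obtain ⟨r, hr⟩ := ((hKc.image H.symm.continuous).isBounded).subset_ball 0
  set r₂ : ℝ := max r 2 with hr₂
  have hr₂1 : 1 < r₂ := lt_of_lt_of_le one_lt_two (le_max_right _ _)
  have hr₂0 : 0 < r₂ := zero_lt_one.trans hr₂1
  have hKsub : K ⊆ H '' ball 0 r₂ := by
    intro z hz
    refine ⟨H.symm z, ?_, H.apply_symm_apply z⟩
    exact ball_subset_ball (le_max_left _ _) (hr ⟨z, hz, rfl⟩)
  -- the envelope
  set f : ℂ ≃ₜ ℂ := H.trans (Homeomorph.addRight (-τ)) with hf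
  have hfapp : ∀ z, f z = H z - τ := fun z => by simp [hf, sub_eq_add_neg]
  have hfimg : ∀ S : Set ℂ, f '' S = (· + (-τ)) '' (H '' S) := fun S => by
    rw [image_image]; rfl
  obtain ⟨hcar, -, -, -⟩ := hDr r₂ hr₂0
  obtain ⟨-, hfr⟩ := hclfr r₂ hr₂0
  set J : JordanDomain := ((Dr r₂).translate (-τ)).toJordanDomain with hJ
  have hJcar : J.carrier = f '' ball 0 r₂ := by
    show ((Dr r₂).translate (-τ)).carrier = _
    rw [MarkedDomain.carrier_translate, hcar, hfimg]
  have hJfr : frontier J.carrier = f '' sphere 0 r₂ := by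
    rw [hJcar]
    show frontier (f '' ball 0 r₂) = f '' sphere 0 r₂
    rw [← f.image_frontier, frontier_ball (0 : ℂ) hr₂0.ne']
  have htrans : (fun z : ℂ => z - τ) = (· + (-τ)) := by ext z; exact sub_eq_add_neg z τ
  have hco : (fun x : ℂ => x + -τ) = ⇑(Homeomorph.addRight (-τ)) := (Homeomorph.coe_addRight (-τ)).symm
  refine ⟨r₂, J, hr₂1, hJcar, hJfr, ?_, ?_, fun i => ?_, fun i => ?_, ?_⟩
  · rw [hfimg, hball, htrans]
  · rw [hfimg, hcl, htrans, hco]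
    exact (Homeomorph.addRight (-τ)).image_closure D.carrier
  · rw [hfapp, ← hpt i]
  · intro z hz
    rw [hJcar, hfimg]
    refine ⟨z + τ, hKsub ?_, by ring⟩
    have hz' : z + τ ∈ closedBall (D.pt i) ϱ₀ := by
      rw [mem_closedBall] at hz ⊢
      rwa [dist_eq_norm, show z + τ - D.pt i = z - (D.pt i - τ) by ring, ← dist_eq_norm]
    fin_cases i
    · exact Or.inl (Or.inl hz')
    · exact Or.inl (Or.inr hz')
  · rw [hJcar, hfimg, htrans, hco, ← (Homeomorph.addRight (-τ)).image_closure]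
    exact image_mono fun z hz => hKsub (Or.inr hz)

end Summit.CriticalPhenomena.SAWScalingLimit.Theorems.ObservableToSLE.TypeLadder

end
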